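import Summits.AtomisticToContinuum.Crystallization.Theorems.OverbindingBudgetAffineNearCollarCut

/-!
# Overbinding budget — «MesoCut», part A: counts, statements and the shadow-packing lemma (decomp-a2c lens-4, generation 74)

Part A of the node «MesoCut» (the cut of M `= AffMidAll 12 (1/25)` at one mesoscopic tolerance; thesis, tags, seam and record cones are in
part B `…Theorems.OverbindingBudgetAffineMesoCut`, which imports this file).  Contents, all PROVED / definitional:
§1 tolerance monotonicity of affine registration (`affFramed_mono`, `affDeepReg_mono_tol`); §2 the two counts of the cut (`mesoBadCount`,
`fineLayerCount`) and the counting identities (`#MID_aff(ε₁) ≤ #MID_aff(ε_h) + #fineLayer`, `#¬meso-good ≤ #¬deep + #MID_aff(ε_h)`,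
`#MID_aff` antitone in the tolerance); §3 the fine-layer statements `BalancedFineLayerGapW` / `TameBalancedFineLayerGap` / FR `FineNonAffinity`
[route statements of this cell; NOT literature facts]; §5a the SHAPE-FREE SHADOW PACKING `notDeepCount_depth_le`
(`#¬L-deep ≤ 27(2Lσ₂+σ₁)³/σ₁³·#¬ρ-deep + #off`, by `card_le_of_cube`) and `affMidCount_depth_le`.
sorry-free · Mathlib + tree only · no new axioms · no instance / notation beyond the tree's file-local `E3`.
-/

namespace Summit.AtomisticToContinuum.Crystallization.Theorems.OverbindingBudgetAffineMesoCut

open scoped BigOperators Classical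
open Literature.MathematicalPhysics.StatisticalMechanics
open Literature.Geometry.DiscreteGeometry (IsChargeFree nearestDist nearestDist_nonneg nearestDist_le_dist)
open Summit.AtomisticToContinuum.Crystallization.Theses.OverbindingBudget (RobustDefectLimitWindows)
open Summit.AtomisticToContinuum.Crystallization.Theses.PricedLinkCensus (ChargedEnergyGap)
open Summit.AtomisticToContinuum.Crystallization.Theorems.OverbindingBudgetGradedBareness (CleanlessExcessT)
open Summit.AtomisticToContinuum.Crystallization.Theorems.OverbindingBudgetCoherentCut (CoherentResidual)
open Summit.AtomisticToContinuum.Crystallization.Theorems.OverbindingBudgetTwoShellShape (TwoShellShape)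
open Summit.AtomisticToContinuum.Crystallization.Theorems.OverbindingBudgetMisfitCensusStatements (card_le_of_cube)
open Summit.AtomisticToContinuum.Crystallization.Theorems.OverbindingBudgetMisfitRegistration (Framed Reg DeepReg)
open Summit.AtomisticToContinuum.Crystallization.Theorems.OverbindingBudgetMisfitWindowStatements (InWindow offCount)
open Summit.AtomisticToContinuum.Crystallization.Theorems.OverbindingBudgetBalancedCensusStatements
open Summit.AtomisticToContinuum.Crystallization.Theorems.OverbindingBudgetBalancedCensusRecord
open Summit.AtomisticToContinuum.Crystallization.Theorems.OverbindingBudgetHarmonicNormalForm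
open Summit.AtomisticToContinuum.Crystallization.Theorems.OverbindingBudgetLocalHarmonicCertificate
open Summit.AtomisticToContinuum.Crystallization.Theorems.OverbindingBudgetAffineLadder
open Summit.AtomisticToContinuum.Crystallization.Theorems.OverbindingBudgetAffineLocalisation
open Summit.AtomisticToContinuum.Crystallization.Theorems.OverbindingBudgetAffineNearCluster

variable {N : ℕ}

local notation "E3" => EuclideanSpace ℝ (Fin 3)

/-! ## §1  Tolerance monotonicity of affine registration (PROVED, definitional) -/

/-- Affine framing is monotone in both tolerances: `AffFramed ε θ g ⇒ AffFramed ε' θ' g` for `ε ≤ ε'`, `θ ≤ θ'`. [this file] -/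
theorem affFramed_mono {ε ε' θ θ' g : ℝ} (hε : ε ≤ ε') (hθ : θ ≤ θ') {y : Fin N → E3} {i : Fin N}
    (h : AffFramed ε θ g y i) : AffFramed ε' θ' g y i := by
  obtain ⟨Q, A, P, f, hP, hAQ, hf, hinj, hcov⟩ := h
  refine ⟨Q, A, P, f, hP, fun v hv => (hAQ v hv).trans hθ, fun v hv => ⟨(hf v hv).1, ?_⟩, hinj, hcov⟩
  exact (hf v hv).2.trans (mul_le_mul_of_nonneg_right hε (nearestDist_nonneg y i))

/-- `AffDeepReg ρ ε θ g ⇒ AffDeepReg ρ ε' θ' g` for `ε ≤ ε'`, `θ ≤ θ'` (same depth). [this file] -/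
theorem affDeepReg_mono_tol {ρ ε ε' θ θ' g : ℝ} (hε : ε ≤ ε') (hθ : θ ≤ θ') {y : Fin N → E3} {i : Fin N}
    (h : AffDeepReg ρ ε θ g y i) : AffDeepReg ρ ε' θ' g y i :=
  fun i' hi' => ⟨(h i' hi').1, affFramed_mono hε hθ (h i' hi').2⟩

/-- A site that is not registered is not `ρ`-deeply registered for any `ρ ≥ 0` (it lies at distance `0 ≤ ρ·nn` of itself). [this file] -/
theorem not_deepReg_of_not_reg {ρ ε g : ℝ} (hρ : 0 ≤ ρ) {y : Fin N → E3} {i : Fin N} (h : ¬ Reg ε g y i) :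
    ¬ DeepReg ρ ε g y i := fun hD => h (hD i (by
  rw [dist_self]; exact mul_nonneg hρ (nearestDist_nonneg y i)))

/-! ## §2  The two counts of the cut and the counting identities (PROVED) -/

/-- Number of sites that are NOT MESOSCOPICALLY GOOD: not both `(ρ, ε)`-deeply registered (similarity frames) and affinely
`(ρ₁, ε_h, θ)`-deeply registered.  (The rebated set of the fine layer statement; `= notDeep ρ ε ∪ MID_aff(ρ → ρ₁, ε_h, θ)`.) -/
noncomputable def mesoBadCount (ρ ρ₁ εh θ ε g : ℝ) (y : Fin N → E3) : ℕ :=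
  Nat.card {i : Fin N // ¬ (DeepReg ρ ε g y i ∧ AffDeepReg ρ₁ εh θ g y i)}

/-- Number of FINE-LAYER sites: mesoscopically good (`(ρ, ε)`-deep and affinely `(ρ₁, ε_h, θ)`-deep) but NOT affinely `(ρ₁, ε₁, θ)`-deep —
the affine-MID sites of the fine tolerance `ε₁` whose whole `ρ₁`-environment is already affinely registered at the mesoscopic tolerance `ε_h`. -/
noncomputable def fineLayerCount (ρ ρ₁ εh ε₁ θ ε g : ℝ) (y : Fin N → E3) : ℕ :=
  Nat.card {i : Fin N // (DeepReg ρ ε g y i ∧ AffDeepReg ρ₁ εh θ g y i) ∧ ¬ AffDeepReg ρ₁ ε₁ θ g y i}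

/-- THE CUT IS A PARTITION (excluded middle on mesoscopic registration): `#MID_aff(ε₁) ≤ #MID_aff(ε_h) + #fineLayer(ε_h, ε₁)`. [this file] -/
theorem affMidCount_le_meso_add_layer {ρ ρ₁ εh ε₁ θ ε g : ℝ} (y : Fin N → E3) :
    affMidCount ρ ρ₁ ε₁ θ ε g y ≤ affMidCount ρ ρ₁ εh θ ε g y + fineLayerCount ρ ρ₁ εh ε₁ θ ε g y := by
  simp only [affMidCount, fineLayerCount, Nat.card_eq_fintype_card, Fintype.card_subtype]
  calc (Finset.univ.filter fun i => DeepReg ρ ε g y i ∧ ¬ AffDeepReg ρ₁ ε₁ θ g y i).card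
      ≤ ((Finset.univ.filter fun i => DeepReg ρ ε g y i ∧ ¬ AffDeepReg ρ₁ εh θ g y i) ∪
          (Finset.univ.filter fun i => (DeepReg ρ ε g y i ∧ AffDeepReg ρ₁ εh θ g y i) ∧ ¬ AffDeepReg ρ₁ ε₁ θ g y i)).card := by
        apply Finset.card_le_card
        intro i hi
        rw [Finset.mem_filter] at hi
        rw [Finset.mem_union, Finset.mem_filter, Finset.mem_filter]
        by_cases hD : AffDeepReg ρ₁ εh θ g y i
        · exact Or.inr ⟨hi.1, ⟨hi.2.1, hD⟩, hi.2.2⟩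
        · exact Or.inl ⟨hi.1, hi.2.1, hD⟩
    _ ≤ _ := Finset.card_union_le _ _

/-- `#¬meso-good ≤ #¬(ρ,ε)-deep + #MID_aff(ε_h)` (excluded middle on coarse depth). [this file] -/
theorem mesoBadCount_le_notDeep_add_affMid {ρ ρ₁ εh θ ε g : ℝ} (y : Fin N → E3) :
    mesoBadCount ρ ρ₁ εh θ ε g y ≤ notDeepCount ρ ε g y + affMidCount ρ ρ₁ εh θ ε g y := by
  simp only [mesoBadCount, notDeepCount, affMidCount, Nat.card_eq_fintype_card, Fintype.card_subtype]
  calc (Finset.univ.filter fun i => ¬ (DeepReg ρ ε g y i ∧ AffDeepReg ρ₁ εh θ g y i)).card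
      ≤ ((Finset.univ.filter fun i => ¬ DeepReg ρ ε g y i) ∪
          (Finset.univ.filter fun i => DeepReg ρ ε g y i ∧ ¬ AffDeepReg ρ₁ εh θ g y i)).card := by
        apply Finset.card_le_card
        intro i hi
        rw [Finset.mem_filter] at hi
        rw [Finset.mem_union, Finset.mem_filter, Finset.mem_filter]
        by_cases hD : DeepReg ρ ε g y i
        · exact Or.inr ⟨hi.1, hD, fun hA => hi.2 ⟨hD, hA⟩⟩
        · exact Or.inl ⟨hi.1, hD⟩
    _ ≤ _ := Finset.card_union_le _ _

/-- Tolerance monotonicity of the MID count: a larger fine tolerance prices fewer sites, `ε_h ≤ ε₁ ⇒ #MID_aff(ε₁) ≤ #MID_aff(ε_h)`. [this file] -/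
theorem affMidCount_anti_tol {ρ ρ₁ εh ε₁ θ ε g : ℝ} (h : εh ≤ ε₁) (y : Fin N → E3) :
    affMidCount ρ ρ₁ ε₁ θ ε g y ≤ affMidCount ρ ρ₁ εh θ ε g y := by
  simp only [affMidCount, Nat.card_eq_fintype_card, Fintype.card_subtype]
  apply Finset.card_le_card
  intro i hi
  rw [Finset.mem_filter] at hi ⊢
  exact ⟨hi.1, hi.2.1, fun hA => hi.2.2 (affDeepReg_mono_tol h le_rfl hA)⟩

/-- The fine layer is a subset of the fine MID set: `#fineLayer(ε_h, ε₁) ≤ #MID_aff(ε₁)`. [this file] -/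
theorem fineLayerCount_le_affMidCount {ρ ρ₁ εh ε₁ θ ε g : ℝ} (y : Fin N → E3) :
    fineLayerCount ρ ρ₁ εh ε₁ θ ε g y ≤ affMidCount ρ ρ₁ ε₁ θ ε g y := by
  simp only [affMidCount, fineLayerCount, Nat.card_eq_fintype_card, Fintype.card_subtype]
  apply Finset.card_le_card
  intro i hi
  rw [Finset.mem_filter] at hi ⊢
  exact ⟨hi.1, hi.2.1.1, hi.2.2⟩

/-- `#¬(ρ,ε)-deep ≤ #¬meso-good`. [this file] -/
theorem notDeepCount_le_mesoBadCount {ρ ρ₁ εh θ ε g : ℝ} (y : Fin N → E3) :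
    notDeepCount ρ ε g y ≤ mesoBadCount ρ ρ₁ εh θ ε g y := by
  simp only [mesoBadCount, notDeepCount, Nat.card_eq_fintype_card, Fintype.card_subtype]
  apply Finset.card_le_card
  intro i hi
  rw [Finset.mem_filter] at hi ⊢
  exact ⟨hi.1, fun hD => hi.2 hD.1⟩

/-- The fine layer is EMPTY at or above the mesoscopic tolerance: `ε_h ≤ ε₁ ⇒ #fineLayer(ε_h, ε₁) = 0`. [this file] -/
theorem fineLayerCount_eq_zero_of_le {ρ ρ₁ εh ε₁ θ ε g : ℝ} (h : εh ≤ ε₁) (y : Fin N → E3) :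
    fineLayerCount ρ ρ₁ εh ε₁ θ ε g y = 0 := by
  simp only [fineLayerCount, Nat.card_eq_fintype_card, Fintype.card_subtype, Finset.card_eq_zero, Finset.filter_eq_empty_iff]
  intro i _ hi
  exact hi.2 (affDeepReg_mono_tol h le_rfl hi.1.2)

/-! ## §3  The two statements of the cut

Both are «[route statement · this cell; NOT a literature fact]».  MR, the mesoscopic piece, is NOT a new declaration: it is the tree's
`TameBalancedAffMidGap L ρ₁ ε_h θ (3/50) (1/450)` (`…AffineLadder`) at ONE tolerance `ε_h` and pricing depth `L` (§5: every depth `L ≥ 0` is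
equivalent to depth `4` modulo constants — the «L-clean normal form»).  FR, the fine piece, is new. -/

/-- **`BalancedFineLayerGapW ρ ρ₁ ε_h ε₁ θ ε g σ₁ σ₂` («FR at one window»)** [route statement · this cell; NOT a literature fact] —
the FINE LAYER is priced in aggregate at `c > 0` per site against the REBATE of every site that is not mesoscopically good:
`N e⋆ + c·#fineLayer(ε_h, ε₁) − C·#¬meso-good(ε_h) − C·#off − C·N^{2/3} − C·(gains) ≤ 𝓔(y)`.  The fine leaf's own shape
(`BalancedAffDeepScaleGapW`: price a registered set, rebate its unregistered complement) one tolerance level up: every PRICED site has a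
whole `ρ₁`-environment affinely registered at the mesoscopic tolerance `ε_h` (perturbative / harmonic regime), everything rougher is rebated. -/
def BalancedFineLayerGapW (ρ ρ₁ εh ε₁ θ ε g σ₁ σ₂ : ℝ) : Prop :=
  ∃ c C : ℝ, 0 < c ∧ ∀ (N : ℕ) (y : Fin N → E3), Function.Injective y →
    ∃ u : E3, ‖u‖ = 1 ∧
      (N : ℝ) * (⨅ Q : PeriodicConfiguration 3, Q.energyPerParticle lennardJones) + c * (fineLayerCount ρ ρ₁ εh ε₁ θ ε g y : ℝ)
        - C * (mesoBadCount ρ ρ₁ εh θ ε g y : ℝ) - C * (offCount σ₁ σ₂ y : ℝ) - C * (N : ℝ) ^ (2 / 3 : ℝ) - C * (dilGain y + shGain u y)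
        ≤ interactionEnergy lennardJones y

/-- **`TameBalancedFineLayerGap ρ ρ₁ ε_h ε₁ θ ε g`** [route statement · this cell; NOT a literature fact] — FR at every window `[δ, 2]`,
`0 < δ ≤ 2`. -/
def TameBalancedFineLayerGap (ρ ρ₁ εh ε₁ θ ε g : ℝ) : Prop :=
  ∀ δ : ℝ, 0 < δ → δ ≤ 2 → BalancedFineLayerGapW ρ ρ₁ εh ε₁ θ ε g δ 2

/-- **FR · `FineNonAffinity ρ₁ ε_h θ`** [route statement · this cell; NOT a literature fact] — the fine layer census at EVERY fine tolerance
`0 < ε₁ ≤ ε_h` below the mesoscopic one, from the registration frame of record `(4, 3/50, 1/450)` (constants may depend on `ε₁`; expected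
`c(ε₁) ≍ κ ε₁² · ρ₁^{-O(1)}`, part B docstring §FR).  NEW · UNDECIDED · ATTACKABLE-L · TRUE-type on paper (perturbative: module docstring §FR). -/
def FineNonAffinity (ρ₁ εh θ : ℝ) : Prop :=
  ∀ ε₁ : ℝ, 0 < ε₁ → ε₁ ≤ εh → TameBalancedFineLayerGap 4 ρ₁ εh ε₁ θ (3 / 50) (1 / 450)

/-! ## §5a  THE L-CLEAN NORMAL FORM, packing half (PROVED): the `L`-shadow of the defects is count-chargeable

`TameBalancedAffMidGap L …` prices only the MID sites whose whole `L·nn`-ball is `(3/50)`-registered (no charged / unframed site in sight — the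
minimal counterexample is DEFECT-FREE out to radius `L`) and rebates every site within `L·nn` of a defect.  Shape-free (no `TwoShellShape`):
in-window sites are `σ₁`-separated (`nearestDist_le_dist`), so the `L`-shadow of a defect holds `≤ 27 (2Lσ₂ + σ₁)³/σ₁³` of them (`card_le_of_cube`). -/

/-- **Shadow packing**: `#¬L-deep ≤ 27(2Lσ₂+σ₁)³/σ₁³ · #¬ρ-deep + #off` for every `ρ, L ≥ 0`, `0 < σ₁ ≤ σ₂` — an in-window site that is not
`L`-deep lies within `L σ₂` of an UNREGISTERED site (itself not `ρ`-deep), and in-window sites are `σ₁`-separated. [this file] -/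
theorem notDeepCount_depth_le {ρ L ε g σ₁ σ₂ : ℝ} (hρ : 0 ≤ ρ) (hL : 0 ≤ L) (hσ : 0 < σ₁) (hσσ : σ₁ ≤ σ₂)
    {y : Fin N → E3} (hy : Function.Injective y) :
    (notDeepCount L ε g y : ℝ) ≤ 27 / σ₁ ^ 3 * (2 * L * σ₂ + σ₁) ^ 3 * notDeepCount ρ ε g y + offCount σ₁ σ₂ y := by
  classical
  set K : ℝ := 27 / σ₁ ^ 3 * (2 * L * σ₂ + σ₁) ^ 3 with hK
  set S : Finset (Fin N) := Finset.univ.filter (fun i => InWindow σ₁ σ₂ y i ∧ ¬ DeepReg L ε g y i) with hS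
  set B : Finset (Fin N) := Finset.univ.filter (fun j => ¬ Reg ε g y j) with hB
  set Dρ : Finset (Fin N) := Finset.univ.filter (fun j => ¬ DeepReg ρ ε g y j) with hDρ
  set Of : Finset (Fin N) := Finset.univ.filter (fun i => ¬ InWindow σ₁ σ₂ y i) with hOf
  have hDL : notDeepCount L ε g y = (Finset.univ.filter fun i => ¬ DeepReg L ε g y i).card := by
    rw [notDeepCount, Nat.card_eq_fintype_card, Fintype.card_subtype]
  have hDρc : notDeepCount ρ ε g y = Dρ.card := by
    rw [notDeepCount, Nat.card_eq_fintype_card, Fintype.card_subtype]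
  have hOfc : offCount σ₁ σ₂ y = Of.card := by
    rw [offCount, Nat.card_eq_fintype_card, Fintype.card_subtype]
  -- split the not-`L`-deep sites by the window
  have hsplit : (Finset.univ.filter fun i => ¬ DeepReg L ε g y i).card ≤ S.card + Of.card := by
    calc (Finset.univ.filter fun i => ¬ DeepReg L ε g y i).card ≤ (S ∪ Of).card := by
          apply Finset.card_le_card
          intro i hi
          rw [Finset.mem_filter] at hi
          rw [Finset.mem_union, Finset.mem_filter, Finset.mem_filter]
          by_cases hw : InWindow σ₁ σ₂ y i
          · exact Or.inl ⟨hi.1, hw, hi.2⟩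
          · exact Or.inr ⟨hi.1, hw⟩
      _ ≤ S.card + Of.card := Finset.card_union_le _ _
  -- unregistered sites are not `ρ`-deep
  have hBD : B.card ≤ Dρ.card := by
    apply Finset.card_le_card
    intro j hj
    rw [Finset.mem_filter] at hj ⊢
    exact ⟨hj.1, not_deepReg_of_not_reg hρ hj.2⟩
  -- the shadow fibres
  set T : Fin N → Finset (Fin N) := fun j => S.filter (fun i => dist (y i) (y j) ≤ L * σ₂) with hT
  have hcover : S ⊆ B.biUnion T := by
    intro i hi
    have hi' := (Finset.mem_filter.1 hi).2
    obtain ⟨⟨-, hhi⟩, hnd⟩ := hi'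
    unfold DeepReg at hnd
    push Not at hnd
    obtain ⟨j, hd, hj⟩ := hnd
    rw [Finset.mem_biUnion]
    refine ⟨j, Finset.mem_filter.2 ⟨Finset.mem_univ _, hj⟩, Finset.mem_filter.2 ⟨hi, ?_⟩⟩
    rw [dist_comm]
    exact hd.trans (mul_le_mul_of_nonneg_left hhi hL)
  have hfib : ∀ j : Fin N, ((T j).card : ℝ) ≤ K := by
    intro j
    have hcardim : ((T j).image y).card = (T j).card := Finset.card_image_of_injective _ hy
    set o : E3 := WithLp.toLp 2 (fun k : Fin 3 => (y j) k - L * σ₂) with ho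
    have hok : ∀ k : Fin 3, o k = (y j) k - L * σ₂ := fun k => rfl
    have hmem : ∀ z ∈ (T j).image y, ∀ k : Fin 3, o k ≤ z k ∧ z k < o k + (2 * L * σ₂ + σ₁) := by
      intro z hz k
      rw [Finset.mem_image] at hz
      obtain ⟨i, hi, rfl⟩ := hz
      have hd : dist (y i) (y j) ≤ L * σ₂ := (Finset.mem_filter.1 hi).2
      have hk : |(y i) k - (y j) k| ≤ dist (y i) (y j) := by
        rw [← Real.dist_eq]
        exact PiLp.dist_apply_le (y i) (y j) k
      have habs := abs_le.1 (hk.trans hd)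
      rw [hok]
      constructor <;> linarith [habs.1, habs.2]
    have hsep : ∀ z ∈ (T j).image y, ∀ w ∈ (T j).image y, z ≠ w → σ₁ ≤ dist z w := by
      intro z hz w hw hzw
      rw [Finset.mem_image] at hz hw
      obtain ⟨i, hi, rfl⟩ := hz
      obtain ⟨i', hi', rfl⟩ := hw
      have hii : i' ≠ i := fun h => hzw (by rw [h])
      have hwin : InWindow σ₁ σ₂ y i := ((Finset.mem_filter.1 (Finset.mem_filter.1 hi).1).2).1
      exact hwin.1.trans (nearestDist_le_dist y hii)
    have hLσ : 0 ≤ L * σ₂ := mul_nonneg hL (by linarith)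
    have h := card_le_of_cube (F := (T j).image y) (o := o) hσ (by linarith) hmem hsep
    rw [hcardim] at h
    rw [hK]
    exact h
  have h1 : S.card ≤ (B.biUnion T).card := Finset.card_le_card hcover
  have h2 : (B.biUnion T).card ≤ ∑ j ∈ B, (T j).card := Finset.card_biUnion_le
  have h3 : (∑ j ∈ B, ((T j).card : ℝ)) ≤ ∑ j ∈ B, K := Finset.sum_le_sum (fun j _ => hfib j)
  rw [Finset.sum_const, nsmul_eq_mul] at h3
  have h12 : (S.card : ℝ) ≤ ∑ j ∈ B, ((T j).card : ℝ) := by exact_mod_cast h1.trans h2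
  have hb : 0 ≤ 2 * L * σ₂ + σ₁ := by nlinarith [mul_nonneg hL (hσ.le.trans hσσ)]
  have hK0 : 0 ≤ K := by rw [hK]; exact mul_nonneg (div_nonneg (by norm_num) (pow_nonneg hσ.le 3)) (pow_nonneg hb 3)
  have hSK : (S.card : ℝ) ≤ K * Dρ.card := by
    calc (S.card : ℝ) ≤ B.card * K := h12.trans h3
      _ ≤ Dρ.card * K := mul_le_mul_of_nonneg_right (by exact_mod_cast hBD) hK0
      _ = K * Dρ.card := by ring
  have hsplit' : (notDeepCount L ε g y : ℝ) ≤ S.card + Of.card := by rw [hDL]; exact_mod_cast hsplit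
  rw [hDρc, hOfc]
  linarith

/-- Counting: `#MID_aff(ρ → ρ₁) ≤ #MID_aff(L → ρ₁) + #¬L-deep` (a `ρ`-deep MID site is `L`-deep or not). [this file] -/
theorem affMidCount_depth_le {ρ L ρ₁ ε₁ θ ε g : ℝ} (y : Fin N → E3) :
    affMidCount ρ ρ₁ ε₁ θ ε g y ≤ affMidCount L ρ₁ ε₁ θ ε g y + notDeepCount L ε g y := by
  simp only [affMidCount, notDeepCount, Nat.card_eq_fintype_card, Fintype.card_subtype]
  calc (Finset.univ.filter fun i => DeepReg ρ ε g y i ∧ ¬ AffDeepReg ρ₁ ε₁ θ g y i).card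
      ≤ ((Finset.univ.filter fun i => DeepReg L ε g y i ∧ ¬ AffDeepReg ρ₁ ε₁ θ g y i) ∪
          (Finset.univ.filter fun i => ¬ DeepReg L ε g y i)).card := by
        apply Finset.card_le_card
        intro i hi
        rw [Finset.mem_filter] at hi
        rw [Finset.mem_union, Finset.mem_filter, Finset.mem_filter]
        by_cases hD : DeepReg L ε g y i
        · exact Or.inl ⟨hi.1, hD, hi.2.2⟩
        · exact Or.inr ⟨hi.1, hD⟩
    _ ≤ _ := Finset.card_union_le _ _

end Summit.AtomisticToContinuum.Crystallization.Theorems.OverbindingBudgetAffineMesoCut
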